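import Summits.RiemannHypothesis.RiemannHypothesis.Theorems.TiltedLandingLaw421R3LandingDoor

/-! # TiltedLandingLaw421 — round 3 SUCC^B: the CUBIC LANDING DOOR and the v9 CANDIDATE law (C1 rh-idea-5 g30, v2; namespace `RhW08.LandingDoor3`)

DRAFT — NOT OF RECORD.  The SUCC law of record is `RhW08.LandingDoor.DoorAvailLawQ8` (v8 = v7 ∨ quadratic «landing», `…R3LandingDoor`, #1124,
registry `trkD_v6q`).  This module types the NEXT rung and the candidate law v9 := v8 ∨ N3, for the day the director keys it under the
DOOR-INTEGRATION RULE (CA441): the in-scope CUBIC LANDING EDGE D1′ (C6 ADD-164c/d: a conjugate pair of zeros of `f^{(j+1)}` converging to a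
legal simple real zero `t` of `f^{(j+1)}` under the lowest state's foot; best v8-door slack = U's ≈ 9.4·ε³ → 0⁺, L absent by structure) is an
inf-slack → 0 family of the law of record that the cubic door lifts to slack → 1 (C6 ADD-165: N3 YES 7/7 on D1′, 0 NO-DOOR / 259, σ_v9 = 0.717).
* `landingModel3 xs c₀ c₁ c₂ c₃ z := c₀ + c₁(z − xs) + c₂(z − xs)² + c₃(z − xs)³` — the REAL CUBIC pinned to the third Taylor polynomial of the
  trace of `f^{(j+1)}` at a real centre (`c₀ = f^{(j+1)}(xs)`, `c₁ = f^{(j+2)}(xs)`, `2c₂ = f^{(j+3)}(xs)`, `6c₃ = f^{(j+4)}(xs)`); degree FIXED at 3,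
  all four coefficients PINNED, free data `(xs, r)` only (a free degree would be the free-model costume).
* socket `LandingNumbersN3` in D1's COUNT currency: `zcountNReal f^{(j)} xs r + 2 ≤ zcountN q₃ xs r` (level-`j` real zeros are charged; the closed
  real pigeonhole `RealCritBoundNSig` = `RhW08.ClusterQM.realCritBoundNSig_holds` converts — nothing about `f^{(j+1)}` on the axis is presumed),
  depth, strict domination on the circle; door `succ_of_landingNumbersN3` PROVED = `tiltClusterLawQB_of_realBound` with `(Q, h, M) := (f^{(j)}, 1, q₃)`.
* `taylor4_defect_of_bound` (MVT ×4, constant `M₄r⁴`; the sharp `M₄r⁴/24` is C4's `landing3_defect_clause_24th`, (T24) 5cd552f2) and `landing3_defect`.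
* §4 the v9 CANDIDATE law `DoorAvailLawQ9` := v8's six sockets ∨ `LandingNumbersN3`, `doorAvail9_of_doorAvail8`, and the compositions
  `antiEscapeCore_of_doorAvail9`, `restSuccBotQ_of_doorAvail9`, `law421Half_of_doorAvail9_rate` (the shape of a registry `trkD_v7q`).
`norm_le_of_deriv_bound` is now taken from the tree (`RhW08.LandingDoor`).
Nothing here bears on the truth of RH; RH is not proved; `TiltedLandingLaw421R` (33346), `AntiEscapeCore`, `DoorAvailLawQ8`, `DoorAvailLawQ9` OPEN. -/

namespace RhW08.LandingDoor3

open Complex Set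
open scoped ComplexConjugate
open Literature.Analysis.Complex
open Summit.RiemannHypothesis.RiemannHypothesis.Theorems.Splittings.JensenWindow
open RhIdea6.G17.W07C7 RhIdea6.G17.W07C7.Rev6 RhIdea6.G18.W07C8.Law421BirthS RhIdea6.G19.W07C11.Seam
open RhIdea6.G20.W07C12.Frac RhIdea6.G20.W07C12.StColP RhW07.C12.FieldSplit RhIdea6.G21.W07C13.TentMax
open RhW07.C14.TwoSided RhW07.C14.Classes RhW07.C14.Lineage RhW07.C14.Booking
open RhW07.C13.Heredity RhIdea6.G22.W07C15pre.Injection RhW07.E3.Cell RhW07.E3.Lit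
open RhW08.Round1 RhW08.StSwap RhW08.Round2 RhW08.QuadW RhW08.SealSwapQ RhW08.SealSwap RhW08.SuccB RhW08.SuccSplit
open RhW08.SuccTheft RhW08.Column RhW08.Hurwitz RhW08.ClusterQ RhW08.ClusterQM RhW08.NewtonDoor RhW08.NewtonDoorGenusOne RhW08.PurseP
open RhW08.AntiEscapeSplit7 RhW08.LandingDoor

/-! ## §1 The real cubic landing model -/

/-- The CUBIC LANDING MODEL at a real point: `q₃(z) := c₀ + c₁(z − xs) + c₂(z − xs)² + c₃(z − xs)³`, real coefficients. -/
noncomputable def landingModel3 (xs c₀ c₁ c₂ c₃ : ℝ) : ℂ → ℂ :=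
  fun z => (c₀ : ℂ) + (c₁ : ℂ) * (z - (xs : ℂ)) + (c₂ : ℂ) * (z - (xs : ℂ)) ^ 2 + (c₃ : ℂ) * (z - (xs : ℂ)) ^ 3

/-- Simp lemma: the cubic landing model evaluated at `z`. -/
@[simp] theorem landingModel3_apply (xs c₀ c₁ c₂ c₃ : ℝ) (z : ℂ) :
    landingModel3 xs c₀ c₁ c₂ c₃ z =
      (c₀ : ℂ) + (c₁ : ℂ) * (z - (xs : ℂ)) + (c₂ : ℂ) * (z - (xs : ℂ)) ^ 2 + (c₃ : ℂ) * (z - (xs : ℂ)) ^ 3 := rfl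

/-- The cubic landing model is differentiable on `ℂ`. -/
theorem differentiable_landingModel3 (xs c₀ c₁ c₂ c₃ : ℝ) : Differentiable ℂ (landingModel3 xs c₀ c₁ c₂ c₃) := by
  unfold landingModel3; fun_prop

/-! ## §2 The socket «cubic landing» (COUNT currency) and its door -/

/-- SOCKET «cubic landing» (F5 rung; all data = the trace of `f^{(j+1)}` at ONE real point up to order 3, one real-centred circle, and the tree's
two counts).  Pinning: `c₀ = f^{(j+1)}(xs)`, `c₁ = f^{(j+2)}(xs)`, `2c₂ = f^{(j+3)}(xs)`, `6c₃ = f^{(j+4)}(xs)` (third Taylor polynomial); depth clause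
of D1 verbatim with `(a, ρ) := (xs, r)`; count `zcountNReal f^{(j)} xs r + 2 ≤ zcountN q₃ xs r`; Rouché domination on the circle. -/
def LandingNumbersN3 (f : ℂ → ℂ) (x₀ R Hs : ℝ) (j : ℕ) : Prop :=
  ∃ xs r c₀ c₁ c₂ c₃ : ℝ, 0 < r ∧
    (|xs - x₀| + r ≤ R / 2 ∨ (max (|xs - x₀| + r - R / 2) 0) ^ 2 + ((j : ℝ) + 1) * r ^ 2 ≤ ((j : ℝ) + 1) * Hs ^ 2) ∧
    (c₀ : ℂ) = iteratedDeriv (j + 1) f xs ∧ (c₁ : ℂ) = iteratedDeriv (j + 2) f xs ∧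
    ((2 * c₂ : ℝ) : ℂ) = iteratedDeriv (j + 3) f xs ∧ ((6 * c₃ : ℝ) : ℂ) = iteratedDeriv (j + 4) f xs ∧
    zcountNReal (iteratedDeriv j f) xs r + 2 ≤ zcountN (landingModel3 xs c₀ c₁ c₂ c₃) xs r ∧
    ∀ z : ℂ, ‖z - (xs : ℂ)‖ = r →
      ‖iteratedDeriv (j + 1) f z - landingModel3 xs c₀ c₁ c₂ c₃ z‖ < ‖landingModel3 xs c₀ c₁ c₂ c₃ z‖

/-- DOOR from «cubic landing» numbers = the landed band-deep tilted cluster door D1 `tiltClusterLawQB_of_realBound` fed `(Q, h, M) := (f^{(j)}, 1, q₃)`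
over the real pigeonhole `RealCritBoundNSig` (the legal real critical point in the window is charged by the pigeonhole, not excluded). -/
theorem succ_of_landingNumbersN3 (hRB : RealCritBoundNSig) {η : ℝ} {f : ℂ → ℂ} {x₀ s hmax R Hs : ℝ} {B j : ℕ} {v : ℂ}
    (hE : EngineHyps5 2 η f x₀ s hmax R Hs B) (hv : StTrkDQ η f x₀ s hmax R Hs B j v) (hnR : ¬ ReadyR2 η f x₀ s hmax R Hs B j v)
    (hL : LandingNumbersN3 f x₀ R Hs j) : ∃ u : ℂ, StTrkDQ η f x₀ s hmax R Hs B (j + 1) u := by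
  obtain ⟨xs, r, c₀, c₁, c₂, c₃, hr, hdepth, -, -, -, -, hn, hdom⟩ := hL
  refine tiltClusterLawQB_of_realBound hRB hE hv hnR hr hdepth
    ⟨iteratedDeriv j f, fun _ => (1 : ℂ), landingModel3 xs c₀ c₁ c₂ c₃, differentiable_iteratedDeriv_of_entire hE.1 j,
      differentiable_const _, differentiable_landingModel3 xs c₀ c₁ c₂ c₃, fun z => by simp, fun _ _ => one_ne_zero, rfl, fun z hz => ?_⟩ hn
  simp only [mul_one]
  rw [← iteratedDeriv_succ]
  exact hdom z hz

/-! ## §3 The closed-form defect (MVT ×4) -/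

/-- FOURTH-ORDER TAYLOR DEFECT (MVT ×4, constant `M₄·r⁴`): for `g` with four derivatives `g₁ … g₄` everywhere and `‖g₄‖ ≤ M₄` on `D̄(c, r)`:
`‖g z − g c − g₁(c)(z − c) − (g₂(c)/2)(z − c)² − (g₃(c)/6)(z − c)³‖ ≤ M₄·r⁴` on `D̄(c, r)`. -/
theorem taylor4_defect_of_bound {g g₁ g₂ g₃ g₄ : ℂ → ℂ} (h₀ : ∀ z, HasDerivAt g (g₁ z) z) (h₁ : ∀ z, HasDerivAt g₁ (g₂ z) z)
    (h₂ : ∀ z, HasDerivAt g₂ (g₃ z) z) (h₃ : ∀ z, HasDerivAt g₃ (g₄ z) z) {c : ℂ} {r M₄ : ℝ}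
    (hM : ∀ z, ‖z - c‖ ≤ r → ‖g₄ z‖ ≤ M₄) {z : ℂ} (hz : ‖z - c‖ ≤ r) :
    ‖g z - g c - g₁ c * (z - c) - g₂ c / 2 * (z - c) ^ 2 - g₃ c / 6 * (z - c) ^ 3‖ ≤ M₄ * r ^ 4 := by
  have hA : ∀ w, ‖w - c‖ ≤ r → ‖(fun w => g₃ w - g₃ c) w‖ ≤ M₄ * r := fun w hw =>
    norm_le_of_deriv_bound (φ := fun w => g₃ w - g₃ c) (φ' := g₄) (fun w => (h₃ w).sub_const _) (sub_self _) hM hw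
  have hB : ∀ w, ‖w - c‖ ≤ r → ‖(fun w => g₂ w - g₂ c - g₃ c * (w - c)) w‖ ≤ M₄ * r * r := fun w hw =>
    norm_le_of_deriv_bound (φ := fun w => g₂ w - g₂ c - g₃ c * (w - c)) (φ' := fun w => g₃ w - g₃ c)
      (fun w => (((h₂ w).sub_const (g₂ c)).sub (((hasDerivAt_id' w).sub_const c).const_mul (g₃ c))).congr_deriv (by ring))
      (by simp) hA hw
  have hC : ∀ w, ‖w - c‖ ≤ r →
      ‖(fun w => g₁ w - g₁ c - g₂ c * (w - c) - g₃ c / 2 * ((w - c) * (w - c))) w‖ ≤ M₄ * r * r * r := fun w hw =>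
    norm_le_of_deriv_bound (φ := fun w => g₁ w - g₁ c - g₂ c * (w - c) - g₃ c / 2 * ((w - c) * (w - c)))
      (φ' := fun w => g₂ w - g₂ c - g₃ c * (w - c))
      (fun w => ((((h₁ w).sub_const (g₁ c)).sub (((hasDerivAt_id' w).sub_const c).const_mul (g₂ c))).sub
        ((((hasDerivAt_id' w).sub_const c).mul ((hasDerivAt_id' w).sub_const c)).const_mul (g₃ c / 2))).congr_deriv (by ring))
      (by simp) hB hw
  have hD : ∀ w, ‖w - c‖ ≤ r →
      ‖(fun w => g w - g c - g₁ c * (w - c) - g₂ c / 2 * ((w - c) * (w - c)) - g₃ c / 6 * ((w - c) * (w - c) * (w - c))) w‖ ≤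
        M₄ * r * r * r * r := fun w hw =>
    norm_le_of_deriv_bound
      (φ := fun w => g w - g c - g₁ c * (w - c) - g₂ c / 2 * ((w - c) * (w - c)) - g₃ c / 6 * ((w - c) * (w - c) * (w - c)))
      (φ' := fun w => g₁ w - g₁ c - g₂ c * (w - c) - g₃ c / 2 * ((w - c) * (w - c)))
      (fun w => (((((h₀ w).sub_const (g c)).sub (((hasDerivAt_id' w).sub_const c).const_mul (g₁ c))).sub
        ((((hasDerivAt_id' w).sub_const c).mul ((hasDerivAt_id' w).sub_const c)).const_mul (g₂ c / 2))).sub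
        (((((hasDerivAt_id' w).sub_const c).mul ((hasDerivAt_id' w).sub_const c)).mul
          ((hasDerivAt_id' w).sub_const c)).const_mul (g₃ c / 6))).congr_deriv
        (by simp only [Pi.mul_apply]; ring))
      (by simp) hC hw
  have h := hD z hz
  simp only at h
  have e : g z - g c - g₁ c * (z - c) - g₂ c / 2 * (z - c) ^ 2 - g₃ c / 6 * (z - c) ^ 3 =
      g z - g c - g₁ c * (z - c) - g₂ c / 2 * ((z - c) * (z - c)) - g₃ c / 6 * ((z - c) * (z - c) * (z - c)) := by ring
  calc ‖g z - g c - g₁ c * (z - c) - g₂ c / 2 * (z - c) ^ 2 - g₃ c / 6 * (z - c) ^ 3‖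
      = ‖g z - g c - g₁ c * (z - c) - g₂ c / 2 * ((z - c) * (z - c)) - g₃ c / 6 * ((z - c) * (z - c) * (z - c))‖ := by rw [e]
    _ ≤ M₄ * r * r * r * r := h
    _ = M₄ * r ^ 4 := by ring

/-- The engine's closed-form defect for the cubic landing model: under the pinning and `‖f^{(j+5)}‖ ≤ M₄` on `D̄(xs, r)`,
`‖f^{(j+1)}(z) − q₃(z)‖ ≤ M₄·r⁴` on `D̄(xs, r)`. -/
theorem landing3_defect {f : ℂ → ℂ} (hf : Differentiable ℂ f) {j : ℕ} {xs r c₀ c₁ c₂ c₃ M₄ : ℝ}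
    (hc₀ : (c₀ : ℂ) = iteratedDeriv (j + 1) f xs) (hc₁ : (c₁ : ℂ) = iteratedDeriv (j + 2) f xs)
    (hc₂ : ((2 * c₂ : ℝ) : ℂ) = iteratedDeriv (j + 3) f xs) (hc₃ : ((6 * c₃ : ℝ) : ℂ) = iteratedDeriv (j + 4) f xs)
    (hM : ∀ z : ℂ, ‖z - (xs : ℂ)‖ ≤ r → ‖iteratedDeriv (j + 5) f z‖ ≤ M₄) {z : ℂ} (hz : ‖z - (xs : ℂ)‖ ≤ r) :
    ‖iteratedDeriv (j + 1) f z - landingModel3 xs c₀ c₁ c₂ c₃ z‖ ≤ M₄ * r ^ 4 := by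
  have hder : ∀ (k : ℕ) (w : ℂ), HasDerivAt (iteratedDeriv k f) (iteratedDeriv (k + 1) f w) w := fun k w => by
    have hk := ((differentiable_iteratedDeriv_of_entire hf k) w).hasDerivAt
    rwa [← iteratedDeriv_succ] at hk
  have key := taylor4_defect_of_bound (hder (j + 1)) (hder (j + 2)) (hder (j + 3)) (hder (j + 4)) hM hz
  have heq : iteratedDeriv (j + 1) f z - landingModel3 xs c₀ c₁ c₂ c₃ z =
      iteratedDeriv (j + 1) f z - iteratedDeriv (j + 1) f xs - iteratedDeriv (j + 2) f xs * (z - xs) -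
        iteratedDeriv (j + 3) f xs / 2 * (z - xs) ^ 2 - iteratedDeriv (j + 4) f xs / 6 * (z - xs) ^ 3 := by
    rw [← hc₀, ← hc₁, ← hc₂, ← hc₃, landingModel3_apply]; push_cast; ring
  rw [heq]; exact key

/-! ## §4 The v9 CANDIDATE law (DRAFT — not of record): v8's six sockets plus «cubic landing» -/

/-- DRAFT v9 DOOR-AVAILABILITY LAW (CANDIDATE ONLY; the residual of record stays `RhW08.LandingDoor.DoorAvailLawQ8` until a director key):
the binders of `AntiEscapeCore` plus simplicity give Newton numbers at `v`, or at a column pair, or pinned real-centred cluster numbers, or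
pinned upper cluster numbers, or landing numbers, or CUBIC LANDING NUMBERS, or a corner-admissible window. -/
def DoorAvailLawQ9 : Prop :=
  ∀ (η : ℝ) (f : ℂ → ℂ) (x₀ s hmax R Hs : ℝ) (B : ℕ), EngineHyps5 2 η f x₀ s hmax R Hs B → ∀ (j : ℕ) (v : ℂ),
    IsLowest StTrkDQ η f x₀ s hmax R Hs B j v → ¬ ReadyR2 η f x₀ s hmax R Hs B j v →
    ¬ AllInBandInRangeWindow f x₀ R Hs j v → ¬ Dimple f j v → DiscOverlap f j v →
    iteratedDeriv (j + 1) f v ≠ 0 →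
    NewtonNumbers f x₀ R Hs j v ∨ NewtonNumbersCol f x₀ R Hs j ∨ ClusterNumbersJ' f x₀ R Hs j ∨ ClusterNumbersU f x₀ R j ∨
      LandingNumbers f x₀ R Hs j ∨ LandingNumbersN3 f x₀ R Hs j ∨ CornerWindow f x₀ R Hs j

/-- v9 is WEAKER than v8 (one more disjunct): whatever proves v8 proves v9 (so `stub_doorAvailLawQ8` implies a `stub_doorAvailLawQ9`). -/
theorem doorAvail9_of_doorAvail8 (hL : DoorAvailLawQ8) : DoorAvailLawQ9 := by
  intro η f x₀ s hmax R Hs B hE j v hlow hnR hwin hdim hov hz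
  rcases hL η f x₀ s hmax R Hs B hE j v hlow hnR hwin hdim hov hz with hN | hNc | hC | hU | hLd | hW
  · exact Or.inl hN
  · exact Or.inr (Or.inl hNc)
  · exact Or.inr (Or.inr (Or.inl hC))
  · exact Or.inr (Or.inr (Or.inr (Or.inl hU)))
  · exact Or.inr (Or.inr (Or.inr (Or.inr (Or.inl hLd))))
  · exact Or.inr (Or.inr (Or.inr (Or.inr (Or.inr (Or.inr hW)))))

/-- v7 ⇒ v9 (through v8). -/
theorem doorAvail9_of_doorAvail7 (hL : DoorAvailLawQ) : DoorAvailLawQ9 :=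
  doorAvail9_of_doorAvail8 (doorAvail8_of_doorAvail7 hL)

/-- ★★ THE v9 SPLIT: the draft law closes `AntiEscapeCore` (seven doors). -/
theorem antiEscapeCore_of_doorAvail9 (hRB : RealCritBoundNSig) (hL : DoorAvailLawQ9) : AntiEscapeCore := by
  intro η f x₀ s hmax R Hs B hE j v hlow hnR hwin hdim hov
  by_cases hz : iteratedDeriv (j + 1) f v = 0
  · exact succ_of_multiple hE hlow.1 hz
  rcases hL η f x₀ s hmax R Hs B hE j v hlow hnR hwin hdim hov hz with hN | hNc | hC | hU | hLd | hN3 | hW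
  · exact succ_of_newtonNumbers hE hlow.1 hN
  · exact succ_of_newtonNumbersCol hE hlow.1 hNc
  · exact succ_of_clusterNumbersJ' hRB hE hlow.1 hnR hC
  · exact succ_of_clusterNumbersU hE hlow.1 hU
  · exact succ_of_landingNumbers hE hlow.1 hLd
  · exact succ_of_landingNumbersN3 hRB hE hlow.1 hnR hN3
  · exact succ_of_cornerWindow hE hlow.1 hnR hW

/-- `RealCritBoundNSig → DoorAvailLawQ9 → RestSuccBotQ`. -/
theorem restSuccBotQ_of_doorAvail9 (hRB : RealCritBoundNSig) (hL : DoorAvailLawQ9) : RestSuccBotQ :=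
  restSuccBotQ_of_pieces dimpleSig_holds (antiEscape_of_core (antiEscapeCore_of_doorAvail9 hRB hL))

/-- The crux text at `κ = ½` from the draft v9 law and the RATE residual. -/
theorem law421Half_of_doorAvail9_rate (hRB : RealCritBoundNSig) (hL : DoorAvailLawQ9) (hR : RestRateBotPQ halfPurse) :
    Law421P halfPurse :=
  law421Half_of_succ_rate (restSuccBotQ_of_doorAvail9 hRB hL) hR

end RhW08.LandingDoor3
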